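import Summits.ValiantsHypothesis.ValiantsHypothesis.Theorems.DivisionGapPerDivisionHardCellContent
import Summits.ValiantsHypothesis.ValiantsHypothesis.Theorems.DivisionGapPerDivisionHardStubCellContentRigidFamily
import Summits.ValiantsHypothesis.ValiantsHypothesis.Theorems.DivisionGapPerDivisionHardStubTorusFamily
import Summits.ValiantsHypothesis.ValiantsHypothesis.Theorems.DivisionGapPerDivisionHardStubProductTorus

/-!
# Crux `DivisionGap.PerDivisionHard` (stmt-ValiantsHypothesis-5065) — the LOW-RANK-PRODUCT rung, unconditionally:
products of arbitrarily many factors of small rank across one balanced partition of the variables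

`PerDivisionHard` asks, for every `c` and all large `n`, that every nonzero cofactor `h ∈ ℝ≥0[x_ij]` satisfies
`2^{(log₂ n + c)^c} < L(per_n · h) + L(h)`.  The cell-content rung (`Theorems/DivisionGapPerDivisionHardCellContent.lean`)
decides every cofactor whose monomials have few `Y`-contents `Φ_Y(m) = (rowDeg(m|_Y), colDeg(m|_Y))` for a balanced
cell set `Y`.  A PRODUCT `h = ∏_i f_i` of such cofactors has in general exponentially many `Y`-contents, but the twins
that a placement must exclude are LOCAL to one factor (the top fibre of a product is the product of the factors' top
fibres over `ℝ≥0`, and each factor's top support must agree off the face if the product's does), so ONE placement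
chosen against the set of ALL factors' contents is rigid for the whole product (`stub_cellContentRigidFamily`):

* `perDivisionHard_lowRankProduct` — **∀ c, ∃ n₀, ∀ n ≥ n₀, ∀ s, ∀ Y with `n² ≤ 4|Y| ≤ 3n²`, ∀ f : Fin s → ℝ≥0[x_ij]:
  if `∏_i f_i ≠ 0` and the monomials of the factors have, all together, at most `2^{(log₂ n + c)^c}` distinct
  `Y`-contents, then `2^{(log₂ n + c)^c} < L(per_n · ∏ f) + L(∏ f)`.**

Examples: `h_bal = ∏_{i ≠ ρ₀} (Σ_j x_ij ∏_{j'≠j} x_{ρ₀ j'})` (each factor has `n` monomials, hence `≤ n` contents for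
any `Y`) — decided in cycle c3 by PRICES (the atomic rung), here by RANK without any weight engineering: the two handles
of the line meet; products of `2^B` factors `Σ_{t<W} f_t(x_Y) g_t(x_{Yᶜ})`; products of sparse factors (the landed
sparse-product rung, `TorusFamily`) and of row-ROABP entries.  Mechanism: factorwise torus normal form
(`stub_torusFamily`, landed c2; `stub_productTorus` p160538) → mode selection (`stub_heavyLines`) → the family placement
(`stub_cellContentRigidFamily`) → face descent → JSS contraction → block arsenal; row mode by transposing every factor
(`stub_transposePair`, `isTorusHomogeneous_rename_swap`).
-/

noncomputable section

-- `Summit.ValiantsHypothesis.ValiantsHypothesis.…` is the tree's mandated single-conjunct layout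
-- (Sub = Summit), so the duplicated namespace component is intended.
set_option linter.dupNamespace false

namespace Summit.ValiantsHypothesis.ValiantsHypothesis.Theorems.DivisionGapPerDivisionHard

open MvPolynomial Literature.Computability.AlgebraicComplexity
open scoped NNReal

variable {n : ℕ}

-- `isTorusHomogeneous_finset_prod` (products of torus-homogeneous polynomials are torus-homogeneous) and
-- `finset_prod_ne_zero_nnreal` come from the landed `Theorems/DivisionGapPerDivisionHardStubProductTorus.lean`.

/-- **Column mode, product form.**  For every `c` there is `n₀` such that for all `n ≥ n₀`, every cell set `Y` with at
least `n/8` live columns, every set `V` of at most `2^{(log₂ n+c)^c}` column-content vectors and every product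
`∏ f'` of nonzero torus-homogeneous factors whose monomials have `Y`-column contents in `V`: if
`L(per·∏ f') ≤ L(per·h)` then `2^{(log₂ n+c)^c} < L(per_n·h) + L(h)`.  (`stub_cellContentRigidFamily` → face descent →
JSS contraction → block arsenal.) [folklore] -/
theorem two_pow_lt_pair_of_lowRankProductCol (c : ℕ) :
    ∃ n₀ : ℕ, ∀ n ≥ n₀, ∀ (h : MvPolynomial (Fin n × Fin n) ℝ≥0) (s : ℕ)
      (f' : Fin s → MvPolynomial (Fin n × Fin n) ℝ≥0),
      ∏ i, f' i ≠ 0 → IsTorusHomogeneous (∏ i, f' i) → (∀ i, IsTorusHomogeneous (f' i)) →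
      complexity (perPoly (Fin n) ℝ≥0 * ∏ i, f' i) ≤ complexity (perPoly (Fin n) ℝ≥0 * h) →
      ∀ (Y : Finset (Fin n × Fin n)) (V : Finset (Fin n → ℕ)),
      n ≤ 8 * (Finset.univ.filter fun cc : Fin n =>
          n / 64 < (Finset.univ.filter fun r : Fin n => (r, cc) ∈ Y).card ∧
          n / 64 < (Finset.univ.filter fun r : Fin n => (r, cc) ∉ Y).card).card →
      V.card ≤ 2 ^ ((Nat.log 2 n + c) ^ c) →
      (∀ i, ((f' i).support.image fun (mm : (Fin n × Fin n) →₀ ℕ) (cc : Fin n) =>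
          ∑ r ∈ Finset.univ.filter (fun r : Fin n => (r, cc) ∈ Y), mm (r, cc)) ⊆ V) →
      2 ^ ((Nat.log 2 n + c) ^ c) < complexity (perPoly (Fin n) ℝ≥0 * h) + complexity h := by
  obtain ⟨κ, hcon⟩ := stub_jssContraction
  obtain ⟨d, n₁, hhard⟩ := stub_blockArsenal c κ
  obtain ⟨n₀, hS⟩ := stub_cellContentRigidFamily c d
  refine ⟨n₀ + n₁, ?_⟩
  intro n hn h s f' hne htor htori hle1 Y V hlive hV hfV
  by_contra hlt
  have hle : complexity (perPoly (Fin n) ℝ≥0 * h) + complexity h ≤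
      2 ^ ((Nat.log 2 n + c) ^ c) := not_lt.mp hlt
  obtain ⟨b, k, m, eR, eC, hb, hfam⟩ := hS n (by omega) Y V hlive hV
  obtain ⟨w, u, hcut, hsingle⟩ := hfam s f' hne htor htori hfV
  have hdesc := stub_faceDescent n (placedBlock eR eC) w (∏ i, f' i) u hcut hne hsingle
  have h1 : complexity (monomial u (1 : ℝ≥0) * facePer (placedBlock eR eC)) ≤
      2 ^ ((Nat.log 2 n + c) ^ c) + 1 :=
    calc complexity (monomial u (1 : ℝ≥0) * facePer (placedBlock eR eC))
        ≤ complexity (perPoly (Fin n) ℝ≥0 * ∏ i, f' i) + 1 := hdesc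
      _ ≤ complexity (perPoly (Fin n) ℝ≥0 * h) + 1 := Nat.add_le_add_right hle1 1
      _ ≤ 2 ^ ((Nat.log 2 n + c) ^ c) + 1 :=
          Nat.add_le_add_right (le_trans (Nat.le_add_right _ _) hle) 1
  have h2 : complexity (facePer (placedBlock eR eC)) ≤
      ((n + 2) * (2 ^ ((Nat.log 2 n + c) ^ c) + 3)) ^ κ :=
    calc complexity (facePer (placedBlock eR eC))
        ≤ ((n + 2) * (complexity (monomial u (1 : ℝ≥0) * facePer (placedBlock eR eC)) + 2)) ^ κ :=
          hcon n (facePer (placedBlock eR eC)) u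
      _ ≤ ((n + 2) * (2 ^ ((Nat.log 2 n + c) ^ c) + 3)) ^ κ :=
          Nat.pow_le_pow_left (Nat.mul_le_mul_left _ (by omega)) κ
  have h3 := hhard n (by omega) b k m eR eC hb
  exact absurd (lt_of_lt_of_le h3 h2) (lt_irrefl _)

/-- **The low-rank-product rung of `PerDivisionHard`.**  For every `c` there is `n₀` such that for all `n ≥ n₀`,
every `s`, every cell set `Y` with `n² ≤ 4|Y| ≤ 3n²` and every family `f : Fin s → ℝ≥0[x_ij]` with `∏_i f_i ≠ 0`: if
the monomials of the factors have, all together, at most `2^{(log₂ n + c)^c}` distinct `Y`-contents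
`Φ_Y(m) = ((Σ_{c:(r,c)∈Y} m(r,c))_r, (Σ_{r:(r,c)∈Y} m(r,c))_c)`, then
`2^{(log₂ n + c)^c} < L(per_n · ∏ f) + L(∏ f)` — however many factors, whatever their degrees, and however large
the rank of the product itself.  Factorwise torus normal form (`stub_torusFamily`), mode selection
(`stub_heavyLines`), column mode directly, row mode by transposing every factor. [folklore] -/
theorem perDivisionHard_lowRankProduct :
    ∀ c : ℕ, ∃ n₀ : ℕ, ∀ n ≥ n₀, ∀ (s : ℕ) (Y : Finset (Fin n × Fin n))
      (f : Fin s → MvPolynomial (Fin n × Fin n) ℝ≥0),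
      n * n ≤ 4 * Y.card → 4 * Y.card ≤ 3 * (n * n) → ∏ i, f i ≠ 0 →
      (Finset.univ.biUnion fun i => (f i).support.image fun (mm : (Fin n × Fin n) →₀ ℕ) =>
          ((fun r : Fin n => ∑ cc ∈ Finset.univ.filter (fun cc : Fin n => (r, cc) ∈ Y), mm (r, cc)),
           (fun cc : Fin n => ∑ r ∈ Finset.univ.filter (fun r : Fin n => (r, cc) ∈ Y), mm (r, cc)))).card ≤
        2 ^ ((Nat.log 2 n + c) ^ c) →
      2 ^ ((Nat.log 2 n + c) ^ c) <
        complexity (perPoly (Fin n) ℝ≥0 * ∏ i, f i) + complexity (∏ i, f i) := by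
  intro c
  obtain ⟨n₀, hcol⟩ := two_pow_lt_pair_of_lowRankProductCol c
  refine ⟨n₀ + 1, fun n hn s Y f hY₁ hY₂ hh hcard => ?_⟩
  classical
  have hn1 : 0 < n := by omega
  -- the contents map and its two projections
  set Φ : ((Fin n × Fin n) →₀ ℕ) → (Fin n → ℕ) × (Fin n → ℕ) := fun mm =>
    ((fun r : Fin n => ∑ cc ∈ Finset.univ.filter (fun cc : Fin n => (r, cc) ∈ Y), mm (r, cc)),
     (fun cc : Fin n => ∑ r ∈ Finset.univ.filter (fun r : Fin n => (r, cc) ∈ Y), mm (r, cc))) with hΦ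
  set U := Finset.univ.biUnion fun i => (f i).support.image Φ with hU
  -- every factor is nonzero; factorwise torus normal form
  have hfne : ∀ i ∈ (Finset.univ : Finset (Fin s)), f i ≠ 0 := fun i _ h0 =>
    hh (Finset.prod_eq_zero (Finset.mem_univ i) h0)
  obtain ⟨f', hf'ne, hf'tor, hf'sub, hle1, -⟩ := stub_torusFamily n (Fin s) Finset.univ f hfne
  have hne' : ∏ i, f' i ≠ 0 := finset_prod_ne_zero_nnreal _ hf'ne
  have htor' : IsTorusHomogeneous (∏ i, f' i) := isTorusHomogeneous_finset_prod _ hf'tor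
  have htori : ∀ i, IsTorusHomogeneous (f' i) := fun i => hf'tor i (Finset.mem_univ i)
  -- contents of the normalised factors lie in `U`
  have hΦsub : ∀ i, (f' i).support.image Φ ⊆ U := fun i =>
    (Finset.image_subset_image (hf'sub i (Finset.mem_univ i))).trans
      (Finset.subset_biUnion_of_mem (fun j => (f j).support.image Φ) (Finset.mem_univ i))
  rcases stub_heavyLines n (n / 64) Y hY₁ hY₂ (Nat.mul_div_le n 64) hn1 with hC | hR
  · -- column mode
    refine hcol n (by omega) (∏ i, f i) s f' hne' htor' htori hle1 Y (U.image Prod.snd) hC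
      (Finset.card_image_le.trans hcard) fun i => ?_
    rw [show (fun (mm : (Fin n × Fin n) →₀ ℕ) (cc : Fin n) =>
          ∑ r ∈ Finset.univ.filter (fun r : Fin n => (r, cc) ∈ Y), mm (r, cc)) = Prod.snd ∘ Φ from rfl,
      ← Finset.image_image]
    exact Finset.image_subset_image (hΦsub i)
  · -- row mode: transpose every factor
    set sw : Fin n × Fin n → Fin n × Fin n := Prod.swap with hsw
    have hswinj : Function.Injective sw := Prod.swap_injective
    set g : Fin s → MvPolynomial (Fin n × Fin n) ℝ≥0 := fun i => rename sw (f' i) with hg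
    have hprod : ∏ i, g i = rename sw (∏ i, f' i) := by rw [map_prod]
    obtain ⟨hle1', -, -⟩ := stub_transposePair n (∏ i, f' i)
    have hgne : ∏ i, g i ≠ 0 := by
      rw [hprod]
      exact fun h0 => hne' (rename_injective sw hswinj (by rw [h0, map_zero]))
    have hgtor : IsTorusHomogeneous (∏ i, g i) := by
      rw [hprod]; exact isTorusHomogeneous_rename_swap htor'
    have hgtori : ∀ i, IsTorusHomogeneous (g i) := fun i => isTorusHomogeneous_rename_swap (htori i)
    have hgle : complexity (perPoly (Fin n) ℝ≥0 * ∏ i, g i) ≤ complexity (perPoly (Fin n) ℝ≥0 * ∏ i, f i) := by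
      rw [hprod]; exact hle1'.trans hle1
    set Y' : Finset (Fin n × Fin n) := Y.image sw with hY'
    have hmemY' : ∀ r cc : Fin n, (r, cc) ∈ Y' ↔ (cc, r) ∈ Y := by
      intro r cc
      rw [hY', Finset.mem_image]
      constructor
      · rintro ⟨⟨a, b⟩, hab, he⟩
        simp only [hsw, Prod.swap_prod_mk, Prod.mk.injEq] at he
        obtain ⟨rfl, rfl⟩ := he
        exact hab
      · intro hmem
        exact ⟨(cc, r), hmem, rfl⟩
    have hlive' : n ≤ 8 * (Finset.univ.filter fun cc : Fin n =>
        n / 64 < (Finset.univ.filter fun r : Fin n => (r, cc) ∈ Y').card ∧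
        n / 64 < (Finset.univ.filter fun r : Fin n => (r, cc) ∉ Y').card).card := by
      refine le_trans hR (le_of_eq ?_)
      congr 2
      ext x
      simp only [Finset.mem_filter, Finset.mem_univ, true_and, hmemY']
    -- the `Y'`-column contents of the transposed factors are the `Y`-row contents of the factors
    have hsub' : ∀ i, ((g i).support.image fun (mm : (Fin n × Fin n) →₀ ℕ) (cc : Fin n) =>
        ∑ r ∈ Finset.univ.filter (fun r : Fin n => (r, cc) ∈ Y'), mm (r, cc)) ⊆ U.image Prod.fst := by
      intro i
      obtain ⟨-, -, hsupp⟩ := stub_transposePair n (f' i)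
      change ((rename sw (f' i)).support.image _) ⊆ _
      rw [hsupp, Finset.image_image]
      rw [show ((fun (mm : (Fin n × Fin n) →₀ ℕ) (cc : Fin n) =>
            ∑ r ∈ Finset.univ.filter (fun r : Fin n => (r, cc) ∈ Y'), mm (r, cc)) ∘ Finsupp.mapDomain sw) =
          Prod.fst ∘ Φ from ?_, ← Finset.image_image]
      · exact Finset.image_subset_image (hΦsub i)
      · funext mm cc
        simp only [Function.comp_apply, hΦ]
        refine Finset.sum_congr (by ext r; simp only [Finset.mem_filter, Finset.mem_univ, true_and, hmemY'])
          fun r _ => ?_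
        change Finsupp.mapDomain sw mm (r, cc) = mm (cc, r)
        rw [show ((r, cc) : Fin n × Fin n) = sw (cc, r) from rfl, Finsupp.mapDomain_apply hswinj]
    exact hcol n (by omega) (∏ i, f i) s g hgne hgtor hgtori hgle Y' (U.image Prod.fst) hlive'
      (Finset.card_image_le.trans hcard) hsub'

end Summit.ValiantsHypothesis.ValiantsHypothesis.Theorems.DivisionGapPerDivisionHard

end
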